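import Summits.QuantumFields.YangMills.Theorems.FemtoTransferGap
import HarnessLib

/-!
# The site-dependent sheet translate `siteTwist k h` — definition

Defs module for the covariant-translate cruxes of seat ym-idea-4's LINE g12-A/B (`ToronSmallBall.ToronCoreRaritySubQuartic` ⟨stmt-QuantumFields-23956⟩,
`OffCoreStripWindowDeep` ⟨23957⟩, `QuantileBitPurity.HolonomyQuantileSubQuartic` ⟨23948⟩, `HolonomyLevyWindowDeep` ⟨23949⟩; memo HOME
`bc/g12-A/PLAN-X1-v2-gauss.md` §2: «the twist element is chosen COVARIANTLY, per plane site»).  The tree's `FemtoTransferGap.twist k z` multiplies every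
link in direction `k` issuing from the plane `x_k = 0` by ONE element `z`; the repaired axis rule of the memo needs the element to depend on the plane
site (`h(s)` = local axis of a fat transverse holonomy / of the Gauss variable), and already the gauge image of a constant sheet translate is
site-dependent: `(twist_k^h U)^g = siteTwist k (x ↦ g(x) h g(x)⁻¹) (U^g)` (companion module `ToronSmallBallSiteTwist`, `gaugeTransform_twist`).  So we define

  `siteTwist k h U (x, i) = h(x) · U(x, i)` if `i = k` and `x_k = 0`, and `U(x, i)` otherwise,

for `h : Site 3 L → G`; `siteTwist k (fun _ => z) = twist k z` definitionally (`siteTwist_const`).  DEFINITION ONLY (+ two sanity lemmas); the identities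
(gauge covariance, measure preservation, time-coupling invariance, plaquette defects, holonomies) are in the companion proof module.
HONEST FRAMING: a fixed-lattice bookkeeping object; nothing about infinite volume, the continuum limit or the Clay gap.
References: [cite: tHooft1979]; [cite: Luscher1983, §2].
-/

set_option autoImplicit false

open Literature.MathematicalPhysics.QuantumFieldTheory
open Literature.MathematicalPhysics.QuantumLattice

namespace Summit.QuantumFields.YangMills.Theorems.FemtoTransferGap

variable {G : Type*} [Group G] {L : ℕ}

/-- **Site-dependent sheet translate** through the plane `x_k = 0`: multiply the link in direction `k` issuing from each plane site `x` (`x_k = 0`) on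
the left by `h x`; every other link is unchanged.  For a constant `h` this is the tree's `twist k (h ·)` ('t Hooft's twist when the value is central).
[cite: tHooft1979] [cite: Luscher1983, §2] -/
def siteTwist (k : Fin 3) (h : Site 3 L → G) (U : GaugeConfig 3 L G) : GaugeConfig 3 L G :=
  fun e => if e.2 = k ∧ e.1 k = 0 then h e.1 * U e else U e

/-- A constant site-dependent translate is the tree's `twist`. [folklore] -/
theorem siteTwist_const (k : Fin 3) (z : G) (U : GaugeConfig 3 L G) : siteTwist k (fun _ => z) U = twist k z U := rfl

/-- Translating by the constant `1` does nothing. [folklore] -/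
@[simp] theorem siteTwist_one (k : Fin 3) (U : GaugeConfig 3 L G) : siteTwist k (fun _ => (1 : G)) U = U := by
  funext e; simp [siteTwist]

end Summit.QuantumFields.YangMills.Theorems.FemtoTransferGap
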